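import Summits.Ventures.YMGap.RobustBall.TorusDoorVariance
import Summits.Ventures.YMGap.RobustBall.TorusClusteringYM3
import HarnessLib

/-!
# Venture YMGap, track Y2 ROBUST-BALL — the ALL-`N` TORUS DOOR with `N`-UNIFORM row value (hypothesis-free):
# tier 1 / up-to-`β⋆` / tier 2 weighted clustering on the torus ball, every `d ≥ 1`, every `N ≥ 2`, and the
# schemas of Y4's receiving predicate `YM3IR.ClusterDomainClustering` for every `SU(N)`, `d = 3`

HONEST FRAMING.  Venture file of the cell `pub-ymgap` (QuantumFields programme), track ROBUST-BALL, seat p1 (g7).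
Strong-coupling LATTICE statements only: `SU(N)` lattice Yang–Mills on finite tori `(ℤ/L)^d`, `L ≥ 3`, at 't Hooft
coupling `t = β/N` (tree coupling `β = N t`), plus a link perturbation in the cell's typed tier-1 / tier-2 balls
(`ClusterDomainFR ε₀ ε₁ r`, `ClusterDomain κ ε₀ ε₁`).  Nothing about the continuum, weak coupling, a transfer-matrix
spectral gap, or the Clay problem.  Kernel ARITHMETIC over tree theorems; no certificate file, no named hypothesis.

PURPOSE.  The Y2 table (rb-theory's `ROBUST-BALL-STATEMENT.md` §5) has an «every `N ≥ 2`» line only in the `ℤ^d`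
currency (p2's `RowsSUN`).  This file supplies the every-`N` lines of the TORUS currencies — and hence of Y4's receiving
predicate in `d = 3`, which today is inhabited hypothesis-free for `SU(2)` only (`TorusRowsYM3`) and on engine-2's
certified pair H1/H2 for `SU(3)` (`TorusRowsSU3YM3`).

MECHANISM.  ds-2's variance-form torus door `robustTorusDoor(W)_of_poincare_of_varianceBound` (Holley–Stroock factor
`e^{a}` on a Poincaré × variance pair, NO self-Lipschitz load) fed with the tree's all-`N` Bakry–Émery pair
`(c, v) = (1/(N(1/2 − b)), N/(1/2 − b))` (`oneLinkPoincareSUN_bakryEmery`, `oneLinkVarianceBound_bakryEmery`) on the radius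
`b = 2(d−1) t < 1/2` of the torus link fields.  Row value
  `ρ_N = e^{ε₀}·6(d−1)t/(1/2 − b) + e^{ε₀/2}·ε₁/√(N(1/2 − b))`,
which is DECREASING in `N`: the `N = 2` value `ρ₂` bounds every `ρ_N`, so ONE certificate `ρ₂ ≤ ρ' < 1` gives, for
EVERY `N ≥ 2` at once, `TorusClusteringOnBallUpTo N d (N t) ε₀ ε₁ r (8N) (−log ρ'/(r ⊔ 1))` (rate uniform in `N`,
constant `8N`) and the tier-2 statement `TorusClusteringOnBallW N d (N t') κ ε₀ ε₁ (8N) κ` for `|t'| ≤ t` when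
`e^{κ}` multiplies the Wilson part.  Zero loads: `24(d−1)… `, i.e. the Shen–Zhu–Zhu window `t < 1/(16(d−1))`.

CONTENT.  §0 numerics toolkit (`exp_le_taylor6`, `one_div_sqrt_le`).  §1 the door and the three clustering currencies
with the `N`-uniform row value (`suN_robustTorusDoor_uniform`, `suN_torusClusteringOnBall_uniform`,
`suN_torusClusteringOnBallUpTo_uniform`, `suN_robustTorusDoorW_uniform`, `suN_torusClusteringOnBallW_uniform`).
§2 ROW SCHEMAS: the same with the exponentials replaced by the Taylor majorant `T₆` and `1/√q` by a rational `s`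
(`suN_torusClusteringOnBallUpTo_of_cert`, `suN_torusClusteringOnBallW_of_cert`) — a row is then ONE `norm_num` call.
§3 Y4: `suN_clusterDomainClustering_dim3_of_cert`, `suN_clusterDomainClusteringW_dim3_of_cert` (every `SU(N)`, `d = 3`).
The numeric rows (every `N ≥ 2`; `d = 4` and the Y4 rows `d = 3`) are in `TorusRowsSUN`.
NOT CLAIMED: optimality; anything sharper than the certified `SU(2)` / `SU(3)` files for `N = 2, 3` (in `SU(2)` Wilson
units `β_W = 4t` these cells sit at `β_W ≤ 1/10`, below `TorusRowsSU2*` / `TorusRowsYM3`); any `ℤ^d` or area-law statement.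
-/

noncomputable section

open MeasureTheory ProbabilityTheory Finset Function Real
open Literature.Probability.LatticeModels Literature.Probability.LatticeModels.DobrushinMetric
open Literature.MathematicalPhysics.QuantumLattice hiding torusNorm
open Literature.MathematicalPhysics.QuantumFieldTheory hiding ZdEdge
open Summit.QuantumFields.BalabanUV.InfraRed.StrongCouplingPoincareDoorSUN (OneLinkPoincareSUN oneLinkPoincareSUN_bakryEmery)
open Summit.QuantumFields.BalabanUV.InfraRed.StrongCouplingVarianceDoorSUN (OneLinkVarianceBound oneLinkVarianceBound_bakryEmery)
open Summit.Ventures.YMGap.RobustBall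

namespace Summit.Ventures.YMGap.RobustBallSUN

variable {d N : ℕ}

/-! ### §0. Numerics toolkit -/

/-- Taylor majorant of the exponential on `[0, 1]` to order six:
`e^x ≤ 1 + x + x²/2 + x³/6 + x⁴/24 + x⁵/120 + (7/4320)·x⁶` (`Real.exp_bound'` with `n = 6`). [folklore] -/
theorem exp_le_taylor6 {x : ℝ} (h0 : 0 ≤ x) (h1 : x ≤ 1) :
    Real.exp x ≤ 1 + x + x ^ 2 / 2 + x ^ 3 / 6 + x ^ 4 / 24 + x ^ 5 / 120 + 7 / 4320 * x ^ 6 := by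
  have h := Real.exp_bound' h0 h1 (n := 6) (by norm_num)
  refine h.trans (le_of_eq ?_)
  simp only [Finset.sum_range_succ, Finset.sum_range_zero, Nat.factorial]
  push_cast
  ring

/-- `1/√q ≤ s` from the rational check `1 ≤ q·s²` (`q > 0`, `s ≥ 0`). [folklore] -/
theorem one_div_sqrt_le {q s : ℝ} (hq : 0 < q) (hs : 0 ≤ s) (h : 1 ≤ q * s ^ 2) : 1 / Real.sqrt q ≤ s := by
  have hsq : 0 < Real.sqrt q := Real.sqrt_pos.2 hq
  rw [div_le_iff₀ hsq]
  have e : Real.sqrt (q * s ^ 2) = Real.sqrt q * s := by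
    rw [Real.sqrt_mul hq.le, Real.sqrt_sq hs]
  calc (1 : ℝ) = Real.sqrt 1 := Real.sqrt_one.symm
    _ ≤ Real.sqrt (q * s ^ 2) := Real.sqrt_le_sqrt h
    _ = s * Real.sqrt q := by rw [e, mul_comm]

/-- The row-value majorant: from `e^{ε₀} ≤ E₀`, `e^{ε₀/2} ≤ E₁`, `1/√q ≤ s` and `A, ε₁, s ≥ 0`,
`e^{ε₀}·A + e^{ε₀/2}·ε₁/√q ≤ E₀·A + E₁·ε₁·s`. [folklore] -/
theorem rowValue_le_of_bounds {A q ε₀ ε₁ E₀ E₁ s : ℝ} (hA : 0 ≤ A) (hε₁ : 0 ≤ ε₁) (hq : 0 < q)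
    (hE₀ : Real.exp ε₀ ≤ E₀) (hE₁ : Real.exp (ε₀ / 2) ≤ E₁) (hs : 1 / Real.sqrt q ≤ s) :
    Real.exp ε₀ * A + Real.exp (ε₀ / 2) * ε₁ / Real.sqrt q ≤ E₀ * A + E₁ * ε₁ * s := by
  have hs0 : 0 ≤ 1 / Real.sqrt q := by positivity
  have h1 : Real.exp ε₀ * A ≤ E₀ * A := mul_le_mul_of_nonneg_right hE₀ hA
  have h2 : Real.exp (ε₀ / 2) * ε₁ / Real.sqrt q ≤ E₁ * ε₁ * s := by
    rw [div_eq_mul_one_div]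
    exact mul_le_mul (mul_le_mul_of_nonneg_right hE₁ hε₁) hs hs0
      (mul_nonneg ((Real.exp_pos _).le.trans hE₁) hε₁)
  linarith

/-- The row value with the Taylor majorants substituted: for `0 ≤ ε₀ ≤ 1`, `A, ε₁, s ≥ 0`, `q > 0`, `1 ≤ q s²`,
`e^{ε₀}·A + e^{ε₀/2}·ε₁/√q ≤ T₆(ε₀)·A + T₆(ε₀/2)·ε₁·s`. [folklore] -/
theorem rowValue_le_taylor {A q ε₀ ε₁ s : ℝ} (hA : 0 ≤ A) (hε₁ : 0 ≤ ε₁) (hq : 0 < q) (h0 : 0 ≤ ε₀) (h1 : ε₀ ≤ 1)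
    (hs : 0 ≤ s) (hqs : 1 ≤ q * s ^ 2) :
    Real.exp ε₀ * A + Real.exp (ε₀ / 2) * ε₁ / Real.sqrt q ≤
      (1 + ε₀ + ε₀ ^ 2 / 2 + ε₀ ^ 3 / 6 + ε₀ ^ 4 / 24 + ε₀ ^ 5 / 120 + 7 / 4320 * ε₀ ^ 6) * A +
        (1 + ε₀ / 2 + (ε₀ / 2) ^ 2 / 2 + (ε₀ / 2) ^ 3 / 6 + (ε₀ / 2) ^ 4 / 24 + (ε₀ / 2) ^ 5 / 120 +
          7 / 4320 * (ε₀ / 2) ^ 6) * ε₁ * s :=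
  rowValue_le_of_bounds hA hε₁ hq (exp_le_taylor6 h0 h1) (exp_le_taylor6 (by linarith) (by linarith))
    (one_div_sqrt_le hq hs hqs)

/-! ### §1. The variance-form torus door on the Bakry–Émery pair, with the `N`-uniform row value -/

/-- Algebra of the Bakry–Émery pair: `√(c v) = 1/(1/2 − b)` and `√c = 1/√(N(1/2 − b))` for
`(c, v) = (1/(N(1/2−b)), N/(1/2−b))`, `N > 0`, `b < 1/2`. [folklore] -/
theorem sqrt_bakryEmeryPair (hN : 0 < (N : ℝ)) {b : ℝ} (hb : b < 1 / 2) :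
    Real.sqrt (1 / ((N : ℝ) * (1 / 2 - b)) * ((N : ℝ) / (1 / 2 - b))) = 1 / (1 / 2 - b) ∧
      Real.sqrt (1 / ((N : ℝ) * (1 / 2 - b))) = 1 / Real.sqrt ((N : ℝ) * (1 / 2 - b)) := by
  have hgap : 0 < 1 / 2 - b := by linarith
  refine ⟨?_, ?_⟩
  · rw [show 1 / ((N : ℝ) * (1 / 2 - b)) * ((N : ℝ) / (1 / 2 - b)) = (1 / (1 / 2 - b)) ^ 2 by
        field_simp, Real.sqrt_sq (by positivity)]
  · rw [Real.sqrt_div' _ (mul_nonneg hN.le hgap.le), Real.sqrt_one]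

/-- **The robust torus door for every `N ≥ 2` with the `N`-UNIFORM row value.**  If `|β|/N ≤ t` and
`b⋆ = 2(d−1) t < 1/2`, every member of `ClusterDomainFR ε₀ ε₁ r` (any `ε₁ ≥ 0`) on every torus `L ≥ 3` is a
Kantorovich–Rubinstein contraction with rows `≤ e^{ε₀}·6(d−1)t/(1/2 − b⋆) + e^{ε₀/2}·ε₁/√(2(1/2 − b⋆))` — the `N = 2`
value of the Bakry–Émery variance-door row, which dominates the value at every `N ≥ 2`. [folklore] -/
theorem suN_robustTorusDoor_uniform (hd : 1 ≤ d) (hN : 2 ≤ N) {β t ε₀ ε₁ : ℝ} (hε₁ : 0 ≤ ε₁)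
    (hβt : |β| / N ≤ t) (ht : t * (2 * ((d : ℝ) - 1)) < 1 / 2) (r : ℕ) :
    RobustTorusDoor N d β ε₀ ε₁ r
      (Real.exp ε₀ * (t * (6 * ((d : ℝ) - 1))) / (1 / 2 - t * (2 * ((d : ℝ) - 1))) +
        Real.exp (ε₀ / 2) * ε₁ / Real.sqrt (2 * (1 / 2 - t * (2 * ((d : ℝ) - 1))))) := by
  set b : ℝ := t * (2 * ((d : ℝ) - 1)) with hbdef
  have hN0 : (0 : ℝ) < N := by exact_mod_cast (show 0 < N by omega)
  have hN2 : (2 : ℝ) ≤ N := by exact_mod_cast hN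
  have hd1 : (0 : ℝ) ≤ (d : ℝ) - 1 := by
    have : (1 : ℝ) ≤ d := by exact_mod_cast hd
    linarith
  have hgap : 0 < 1 / 2 - b := by linarith
  have ht0 : 0 ≤ t := le_trans (by positivity) hβt
  have hP := oneLinkPoincareSUN_bakryEmery hN ht
  have hV := oneLinkVarianceBound_bakryEmery hN ht
  have hc : (0 : ℝ) ≤ 1 / ((N : ℝ) * (1 / 2 - b)) := by positivity
  have hv : (0 : ℝ) ≤ (N : ℝ) / (1 / 2 - b) := by positivity
  have hbβ : |β| / N * (2 * ((d : ℝ) - 1)) ≤ b := mul_le_mul_of_nonneg_right hβt (by positivity)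
  have hdoor := robustTorusDoor_of_poincare_of_varianceBound (ε₀ := ε₀) (ε₁ := ε₁) hd (by omega) hc hv hbβ hP hV r
  obtain ⟨e1, e2⟩ := sqrt_bakryEmeryPair (N := N) hN0 ht
  rw [e1, e2] at hdoor
  refine hdoor.mono (add_le_add ?_ ?_)
  · -- Wilson part: `(|β|/N)·6(d−1) ≤ t·6(d−1)`
    have h6 : |β| / N * (6 * ((d : ℝ) - 1)) ≤ t * (6 * ((d : ℝ) - 1)) :=
      mul_le_mul_of_nonneg_right hβt (by positivity)
    calc Real.exp ε₀ * (1 / (1 / 2 - b)) * (|β| / N) * (6 * ((d : ℝ) - 1))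
        = Real.exp ε₀ * (|β| / N * (6 * ((d : ℝ) - 1))) / (1 / 2 - b) := by ring
      _ ≤ Real.exp ε₀ * (t * (6 * ((d : ℝ) - 1))) / (1 / 2 - b) :=
          div_le_div_of_nonneg_right (mul_le_mul_of_nonneg_left h6 (Real.exp_pos _).le) hgap.le
  · -- cross part: `1/√(N(1/2−b)) ≤ 1/√(2(1/2−b))`
    have hs : 1 / Real.sqrt ((N : ℝ) * (1 / 2 - b)) ≤ 1 / Real.sqrt (2 * (1 / 2 - b)) :=
      one_div_le_one_div_of_le (Real.sqrt_pos.2 (by positivity))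
        (Real.sqrt_le_sqrt (mul_le_mul_of_nonneg_right hN2 hgap.le))
    calc Real.exp (ε₀ / 2) * (1 / Real.sqrt ((N : ℝ) * (1 / 2 - b))) * ε₁
        = Real.exp (ε₀ / 2) * ε₁ * (1 / Real.sqrt ((N : ℝ) * (1 / 2 - b))) := by ring
      _ ≤ Real.exp (ε₀ / 2) * ε₁ * (1 / Real.sqrt (2 * (1 / 2 - b))) :=
          mul_le_mul_of_nonneg_left hs (by positivity)
      _ = Real.exp (ε₀ / 2) * ε₁ / Real.sqrt (2 * (1 / 2 - b)) := by ring

/-- **Torus clustering on the tier-1 ball, every `N ≥ 2`, `N`-uniform rate**: with `|β|/N ≤ t`, `2(d−1)t < 1/2` and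
`ρ₂ = e^{ε₀}·6(d−1)t/(1/2 − 2(d−1)t) + e^{ε₀/2}·ε₁/√(2(1/2 − 2(d−1)t)) ∈ (0, 1)`:
`TorusClusteringOnBall N d β ε₀ ε₁ r (8N) (−log ρ₂/(r ⊔ 1))`. [folklore] -/
theorem suN_torusClusteringOnBall_uniform (hd : 1 ≤ d) (hN : 2 ≤ N) {β t ε₀ ε₁ : ℝ} (hε₁ : 0 ≤ ε₁)
    (hβt : |β| / N ≤ t) (ht : t * (2 * ((d : ℝ) - 1)) < 1 / 2) (r : ℕ)
    (hρ0 : 0 < Real.exp ε₀ * (t * (6 * ((d : ℝ) - 1))) / (1 / 2 - t * (2 * ((d : ℝ) - 1))) +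
        Real.exp (ε₀ / 2) * ε₁ / Real.sqrt (2 * (1 / 2 - t * (2 * ((d : ℝ) - 1)))))
    (hρ1 : Real.exp ε₀ * (t * (6 * ((d : ℝ) - 1))) / (1 / 2 - t * (2 * ((d : ℝ) - 1))) +
        Real.exp (ε₀ / 2) * ε₁ / Real.sqrt (2 * (1 / 2 - t * (2 * ((d : ℝ) - 1)))) < 1) :
    TorusClusteringOnBall N d β ε₀ ε₁ r (8 * N)
      (-Real.log (Real.exp ε₀ * (t * (6 * ((d : ℝ) - 1))) / (1 / 2 - t * (2 * ((d : ℝ) - 1))) +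
          Real.exp (ε₀ / 2) * ε₁ / Real.sqrt (2 * (1 / 2 - t * (2 * ((d : ℝ) - 1))))) / max r 1) :=
  clusteringFromDoorTarget_holds N d β ε₀ ε₁ _ r (suN_robustTorusDoor_uniform hd hN hε₁ hβt ht r) hρ0 hρ1

/-- **Torus clustering UP TO `β⋆ = N t`, every `N ≥ 2`, from ONE majorant `ρ₂ ≤ ρ' < 1`** (`0 < ρ'`, `t ≥ 0`,
`2(d−1)t < 1/2`): `TorusClusteringOnBallUpTo N d (N t) ε₀ ε₁ r (8N) (−log ρ'/(r ⊔ 1))` — the rate does not depend on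
`N`. [folklore] -/
theorem suN_torusClusteringOnBallUpTo_uniform (hd : 1 ≤ d) (hN : 2 ≤ N) {t ε₀ ε₁ ρ' : ℝ} (hε₁ : 0 ≤ ε₁)
    (ht : t * (2 * ((d : ℝ) - 1)) < 1 / 2) (r : ℕ)
    (hle : Real.exp ε₀ * (t * (6 * ((d : ℝ) - 1))) / (1 / 2 - t * (2 * ((d : ℝ) - 1))) +
        Real.exp (ε₀ / 2) * ε₁ / Real.sqrt (2 * (1 / 2 - t * (2 * ((d : ℝ) - 1)))) ≤ ρ')
    (hρ'0 : 0 < ρ') (hρ'1 : ρ' < 1) :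
    TorusClusteringOnBallUpTo N d (N * t) ε₀ ε₁ r (8 * N) (-Real.log ρ' / max r 1) := by
  intro β hβ0 hββs
  have hN0 : (0 : ℝ) < N := by exact_mod_cast (show 0 < N by omega)
  have hβt : |β| / N ≤ t := by
    rw [abs_of_nonneg hβ0, div_le_iff₀ hN0, mul_comm]
    exact hββs
  exact clusteringFromDoorTarget_holds N d β ε₀ ε₁ _ r
    ((suN_robustTorusDoor_uniform hd hN hε₁ hβt ht r).mono hle) hρ'0 hρ'1

/-- A tier-2 door with a smaller weighted row bound is one with a larger bound. [folklore] -/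
theorem robustTorusDoorW_mono {β κ ε₀ ε₁ t ρ ρ' : ℝ} (h : RobustTorusDoorW N d β κ ε₀ ε₁ t ρ) (hle : ρ ≤ ρ') :
    RobustTorusDoorW N d β κ ε₀ ε₁ t ρ' := fun L _ hL W hW => by
  obtain ⟨nbr, C, hKR, hrow⟩ := h L hL W hW
  exact ⟨nbr, C, hKR, fun e => (hrow e).trans hle⟩

/-- **The tier-2 (weighted) torus door for every `N ≥ 2` with the `N`-UNIFORM row value** (`κ ≥ 0`, `|β|/N ≤ t`,
`2(d−1)t < 1/2`): weighted rows `≤ e^{κ}·e^{ε₀}·6(d−1)t/(1/2 − 2(d−1)t) + e^{ε₀/2}·ε₁/√(2(1/2 − 2(d−1)t))`. [folklore] -/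
theorem suN_robustTorusDoorW_uniform (hd : 1 ≤ d) (hN : 2 ≤ N) {β κ t ε₀ ε₁ : ℝ} (hκ : 0 ≤ κ) (hε₁ : 0 ≤ ε₁)
    (hβt : |β| / N ≤ t) (ht : t * (2 * ((d : ℝ) - 1)) < 1 / 2) :
    RobustTorusDoorW N d β κ ε₀ ε₁ κ
      (Real.exp κ * Real.exp ε₀ * (t * (6 * ((d : ℝ) - 1))) / (1 / 2 - t * (2 * ((d : ℝ) - 1))) +
        Real.exp (ε₀ / 2) * ε₁ / Real.sqrt (2 * (1 / 2 - t * (2 * ((d : ℝ) - 1))))) := by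
  set b : ℝ := t * (2 * ((d : ℝ) - 1)) with hbdef
  have hN0 : (0 : ℝ) < N := by exact_mod_cast (show 0 < N by omega)
  have hN2 : (2 : ℝ) ≤ N := by exact_mod_cast hN
  have hd1 : (0 : ℝ) ≤ (d : ℝ) - 1 := by
    have : (1 : ℝ) ≤ d := by exact_mod_cast hd
    linarith
  have hgap : 0 < 1 / 2 - b := by linarith
  have ht0 : 0 ≤ t := le_trans (by positivity) hβt
  have hP := oneLinkPoincareSUN_bakryEmery hN ht
  have hV := oneLinkVarianceBound_bakryEmery hN ht
  have hc : (0 : ℝ) ≤ 1 / ((N : ℝ) * (1 / 2 - b)) := by positivity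
  have hv : (0 : ℝ) ≤ (N : ℝ) / (1 / 2 - b) := by positivity
  have hbβ : |β| / N * (2 * ((d : ℝ) - 1)) ≤ b := mul_le_mul_of_nonneg_right hβt (by positivity)
  have hdoor := robustTorusDoorW_of_poincare_of_varianceBound (ε₀ := ε₀) (ε₁ := ε₁) hd (by omega) hκ hc hv hbβ
    hP hV
  obtain ⟨e1, e2⟩ := sqrt_bakryEmeryPair (N := N) hN0 ht
  rw [e1, e2] at hdoor
  refine robustTorusDoorW_mono hdoor (add_le_add ?_ ?_)
  · have h6 : |β| / N * (6 * ((d : ℝ) - 1)) ≤ t * (6 * ((d : ℝ) - 1)) :=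
      mul_le_mul_of_nonneg_right hβt (by positivity)
    calc Real.exp κ * Real.exp ε₀ * (1 / (1 / 2 - b)) * (|β| / N) * (6 * ((d : ℝ) - 1))
        = Real.exp κ * Real.exp ε₀ * (|β| / N * (6 * ((d : ℝ) - 1))) / (1 / 2 - b) := by ring
      _ ≤ Real.exp κ * Real.exp ε₀ * (t * (6 * ((d : ℝ) - 1))) / (1 / 2 - b) :=
          div_le_div_of_nonneg_right (mul_le_mul_of_nonneg_left h6 (by positivity)) hgap.le
  · have hs : 1 / Real.sqrt ((N : ℝ) * (1 / 2 - b)) ≤ 1 / Real.sqrt (2 * (1 / 2 - b)) :=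
      one_div_le_one_div_of_le (Real.sqrt_pos.2 (by positivity))
        (Real.sqrt_le_sqrt (mul_le_mul_of_nonneg_right hN2 hgap.le))
    calc Real.exp (ε₀ / 2) * (1 / Real.sqrt ((N : ℝ) * (1 / 2 - b))) * ε₁
        = Real.exp (ε₀ / 2) * ε₁ * (1 / Real.sqrt ((N : ℝ) * (1 / 2 - b))) := by ring
      _ ≤ Real.exp (ε₀ / 2) * ε₁ * (1 / Real.sqrt (2 * (1 / 2 - b))) :=
          mul_le_mul_of_nonneg_left hs (by positivity)
      _ = Real.exp (ε₀ / 2) * ε₁ / Real.sqrt (2 * (1 / 2 - b)) := by ring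

/-- **Torus clustering on the tier-2 ball, every `N ≥ 2`** (`κ ≥ 0`, `|β|/N ≤ t`, `2(d−1)t < 1/2`): rate `κ`, constant
`8N`, whenever the `N`-uniform weighted row value is `≤ ρ' < 1`. [folklore] -/
theorem suN_torusClusteringOnBallW_uniform (hd : 1 ≤ d) (hN : 2 ≤ N) {β κ t ε₀ ε₁ ρ' : ℝ} (hκ : 0 ≤ κ)
    (hε₁ : 0 ≤ ε₁) (hβt : |β| / N ≤ t) (ht : t * (2 * ((d : ℝ) - 1)) < 1 / 2)
    (hle : Real.exp κ * Real.exp ε₀ * (t * (6 * ((d : ℝ) - 1))) / (1 / 2 - t * (2 * ((d : ℝ) - 1))) +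
        Real.exp (ε₀ / 2) * ε₁ / Real.sqrt (2 * (1 / 2 - t * (2 * ((d : ℝ) - 1)))) ≤ ρ')
    (hρ'1 : ρ' < 1) :
    TorusClusteringOnBallW N d β κ ε₀ ε₁ (8 * N) κ := by
  have hd1 : (0 : ℝ) ≤ (d : ℝ) - 1 := by
    have : (1 : ℝ) ≤ d := by exact_mod_cast hd
    linarith
  have ht0 : 0 ≤ t := le_trans (by positivity) hβt
  have hgap : 0 < 1 / 2 - t * (2 * ((d : ℝ) - 1)) := by linarith
  have hρ0 : 0 ≤ ρ' := le_trans (by positivity) hle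
  exact clusteringFromWeightedDoorTarget_holds N d β κ ε₀ ε₁ κ _
    (robustTorusDoorW_mono (suN_robustTorusDoorW_uniform hd hN hκ hε₁ hβt ht) hle) hκ hρ0 hρ'1

/-! ### §2. Row schemas: ONE rational certificate serves every `N ≥ 2` -/

/-- **ROW SCHEMA, tier 1 / up to `β⋆ = N t`, every `N ≥ 2`, every `d ≥ 1`.**  Data: `t ≥ 0` with `b = 2(d−1)t < 1/2`,
radii `0 ≤ ε₀ ≤ 1`, `0 ≤ ε₁`, a rational `s ≥ 0` with `1 ≤ 2(1/2 − b)·s²` (so `s ≥ 1/√(2(1/2 − b))`) and a ceiling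
`0 < ρ' < 1` with the RATIONAL certificate `T₆(ε₀)·6(d−1)t/(1/2 − b) + T₆(ε₀/2)·ε₁·s ≤ ρ'`
(`T₆(x) = 1 + x + x²/2 + x³/6 + x⁴/24 + x⁵/120 + (7/4320)x⁶ ≥ e^x` on `[0,1]`).  Conclusion:
`TorusClusteringOnBallUpTo N d (N t) ε₀ ε₁ r (8N) (−log ρ'/(r ⊔ 1))`. [folklore] -/
theorem suN_torusClusteringOnBallUpTo_of_cert (hd : 1 ≤ d) (hN : 2 ≤ N) {t ε₀ ε₁ s ρ' : ℝ} (ht0 : 0 ≤ t)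
    (ht : t * (2 * ((d : ℝ) - 1)) < 1 / 2) (h0 : 0 ≤ ε₀) (h1 : ε₀ ≤ 1) (hε₁ : 0 ≤ ε₁) (hs : 0 ≤ s)
    (hqs : 1 ≤ 2 * (1 / 2 - t * (2 * ((d : ℝ) - 1))) * s ^ 2) (r : ℕ)
    (hcert : (1 + ε₀ + ε₀ ^ 2 / 2 + ε₀ ^ 3 / 6 + ε₀ ^ 4 / 24 + ε₀ ^ 5 / 120 + 7 / 4320 * ε₀ ^ 6) *
        (t * (6 * ((d : ℝ) - 1)) / (1 / 2 - t * (2 * ((d : ℝ) - 1)))) +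
      (1 + ε₀ / 2 + (ε₀ / 2) ^ 2 / 2 + (ε₀ / 2) ^ 3 / 6 + (ε₀ / 2) ^ 4 / 24 + (ε₀ / 2) ^ 5 / 120 +
        7 / 4320 * (ε₀ / 2) ^ 6) * ε₁ * s ≤ ρ')
    (hρ'0 : 0 < ρ') (hρ'1 : ρ' < 1) :
    TorusClusteringOnBallUpTo N d (N * t) ε₀ ε₁ r (8 * N) (-Real.log ρ' / max r 1) := by
  have hd1 : (0 : ℝ) ≤ (d : ℝ) - 1 := by
    have : (1 : ℝ) ≤ d := by exact_mod_cast hd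
    linarith
  have hgap : 0 < 1 / 2 - t * (2 * ((d : ℝ) - 1)) := by linarith
  have hA : 0 ≤ t * (6 * ((d : ℝ) - 1)) / (1 / 2 - t * (2 * ((d : ℝ) - 1))) := by positivity
  refine suN_torusClusteringOnBallUpTo_uniform hd hN hε₁ ht r (le_trans ?_ hcert) hρ'0 hρ'1
  have h := rowValue_le_taylor hA hε₁ (by positivity : 0 < 2 * (1 / 2 - t * (2 * ((d : ℝ) - 1)))) h0 h1 hs hqs
    (ε₁ := ε₁)
  rw [mul_div_assoc]
  exact h

/-- **ROW SCHEMA, tier 2 (weight `e^{κ} = w ≥ 1`), every `N ≥ 2`, every `d ≥ 1`**, at any tree coupling `β` with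
`|β|/N ≤ t`: the rational certificate `w·T₆(ε₀)·6(d−1)t/(1/2 − b) + T₆(ε₀/2)·ε₁·s ≤ ρ' < 1` gives
`TorusClusteringOnBallW N d β (log w) ε₀ ε₁ (8N) (log w)`. [folklore] -/
theorem suN_torusClusteringOnBallW_of_cert (hd : 1 ≤ d) (hN : 2 ≤ N) {β w t ε₀ ε₁ s ρ' : ℝ} (hw : 1 ≤ w)
    (hβt : |β| / N ≤ t) (ht : t * (2 * ((d : ℝ) - 1)) < 1 / 2) (h0 : 0 ≤ ε₀) (h1 : ε₀ ≤ 1) (hε₁ : 0 ≤ ε₁)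
    (hs : 0 ≤ s) (hqs : 1 ≤ 2 * (1 / 2 - t * (2 * ((d : ℝ) - 1))) * s ^ 2)
    (hcert : w * (1 + ε₀ + ε₀ ^ 2 / 2 + ε₀ ^ 3 / 6 + ε₀ ^ 4 / 24 + ε₀ ^ 5 / 120 + 7 / 4320 * ε₀ ^ 6) *
        (t * (6 * ((d : ℝ) - 1)) / (1 / 2 - t * (2 * ((d : ℝ) - 1)))) +
      (1 + ε₀ / 2 + (ε₀ / 2) ^ 2 / 2 + (ε₀ / 2) ^ 3 / 6 + (ε₀ / 2) ^ 4 / 24 + (ε₀ / 2) ^ 5 / 120 +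
        7 / 4320 * (ε₀ / 2) ^ 6) * ε₁ * s ≤ ρ')
    (hρ'1 : ρ' < 1) :
    TorusClusteringOnBallW N d β (Real.log w) ε₀ ε₁ (8 * N) (Real.log w) := by
  have hd1 : (0 : ℝ) ≤ (d : ℝ) - 1 := by
    have : (1 : ℝ) ≤ d := by exact_mod_cast hd
    linarith
  have ht0 : 0 ≤ t := le_trans (by positivity) hβt
  have hgap : 0 < 1 / 2 - t * (2 * ((d : ℝ) - 1)) := by linarith
  have hw0 : 0 < w := by linarith
  have hA : 0 ≤ t * (6 * ((d : ℝ) - 1)) / (1 / 2 - t * (2 * ((d : ℝ) - 1))) := by positivity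
  refine suN_torusClusteringOnBallW_uniform hd hN (Real.log_nonneg hw) hε₁ hβt ht (le_trans ?_ hcert) hρ'1
  rw [Real.exp_log hw0]
  have h := rowValue_le_taylor (mul_nonneg hw0.le hA) hε₁
    (by positivity : 0 < 2 * (1 / 2 - t * (2 * ((d : ℝ) - 1)))) h0 h1 hs hqs (ε₁ := ε₁)
  calc w * Real.exp ε₀ * (t * (6 * ((d : ℝ) - 1))) / (1 / 2 - t * (2 * ((d : ℝ) - 1))) +
        Real.exp (ε₀ / 2) * ε₁ / Real.sqrt (2 * (1 / 2 - t * (2 * ((d : ℝ) - 1))))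
      = Real.exp ε₀ * (w * (t * (6 * ((d : ℝ) - 1)) / (1 / 2 - t * (2 * ((d : ℝ) - 1))))) +
        Real.exp (ε₀ / 2) * ε₁ / Real.sqrt (2 * (1 / 2 - t * (2 * ((d : ℝ) - 1)))) := by ring
    _ ≤ _ := h
    _ = _ := by ring

/-! ### §3. Y4's receiving predicate for every `SU(N)`, `d = 3` -/

/-- **Y4's receiving conjecture INHABITED for every `SU(N)`, `N ≥ 2`, `d = 3`, tier 1** (hypothesis-free): with
`b = 4t < 1/2` and the rational certificate of `suN_torusClusteringOnBallUpTo_of_cert` at `d = 3`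
(`T₆(ε₀)·12t/(1/2 − 4t) + T₆(ε₀/2)·ε₁·s ≤ ρ' < 1`, `1 ≤ 2(1/2 − 4t)s²`), the ball spec (fundamental `SU(N)`, ceiling
`β⋆ = N t`, membership in `ClusterDomainFR ε₀ ε₁ r`) satisfies `ClusterDomainClustering … suFrobDist (−log ρ'/(r ⊔ 1))`.
[folklore] -/
theorem suN_clusterDomainClustering_dim3_of_cert (hN : 2 ≤ N) {t ε₀ ε₁ s ρ' : ℝ} (ht0 : 0 ≤ t) (ht : t * 4 < 1 / 2)
    (h0 : 0 ≤ ε₀) (h1 : ε₀ ≤ 1) (hε₁ : 0 ≤ ε₁) (hs : 0 ≤ s) (hqs : 1 ≤ 2 * (1 / 2 - t * 4) * s ^ 2) (r : ℕ)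
    (hcert : (1 + ε₀ + ε₀ ^ 2 / 2 + ε₀ ^ 3 / 6 + ε₀ ^ 4 / 24 + ε₀ ^ 5 / 120 + 7 / 4320 * ε₀ ^ 6) *
        (t * 12 / (1 / 2 - t * 4)) +
      (1 + ε₀ / 2 + (ε₀ / 2) ^ 2 / 2 + (ε₀ / 2) ^ 3 / 6 + (ε₀ / 2) ^ 4 / 24 + (ε₀ / 2) ^ 5 / 120 +
        7 / 4320 * (ε₀ / 2) ^ 6) * ε₁ * s ≤ ρ')
    (hρ'0 : 0 < ρ') (hρ'1 : ρ' < 1) :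
    YM3IR.ClusterDomainClustering (G := SUN N)
      ⟨fundamentalRep (Fin N), N * t, fun _ _ W => W ∈ ClusterDomainFR ε₀ ε₁ r⟩ suFrobDist
      (-Real.log ρ' / max r 1) := by
  have e4 : (2 : ℝ) * (((3 : ℕ) : ℝ) - 1) = 4 := by norm_num
  have e12 : (6 : ℝ) * (((3 : ℕ) : ℝ) - 1) = 12 := by norm_num
  refine clusterDomainClustering_of_torusClusteringOnBallUpTo
    (suN_torusClusteringOnBallUpTo_of_cert (d := 3) (by norm_num) hN ht0 (by rw [e4]; exact ht) h0 h1 hε₁ hs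
      (by rw [e4]; exact hqs) r (by rw [e4, e12]; exact hcert) hρ'0 hρ'1)

/-- **Y4's receiving conjecture INHABITED for every `SU(N)`, `N ≥ 2`, `d = 3`, tier 2** (weight `e^{κ} = w ≥ 1`,
hypothesis-free): the rational certificate `w·T₆(ε₀)·12t/(1/2 − 4t) + T₆(ε₀/2)·ε₁·s ≤ ρ' < 1` gives
`ClusterDomainClustering` for membership in the diameter-weighted ball `ClusterDomain (log w) ε₀ ε₁` up to `β⋆ = N t`,
rate `log w`. [folklore] -/
theorem suN_clusterDomainClusteringW_dim3_of_cert (hN : 2 ≤ N) {w t ε₀ ε₁ s ρ' : ℝ} (hw : 1 ≤ w)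
    (ht : t * 4 < 1 / 2) (h0 : 0 ≤ ε₀) (h1 : ε₀ ≤ 1) (hε₁ : 0 ≤ ε₁) (hs : 0 ≤ s)
    (hqs : 1 ≤ 2 * (1 / 2 - t * 4) * s ^ 2)
    (hcert : w * (1 + ε₀ + ε₀ ^ 2 / 2 + ε₀ ^ 3 / 6 + ε₀ ^ 4 / 24 + ε₀ ^ 5 / 120 + 7 / 4320 * ε₀ ^ 6) *
        (t * 12 / (1 / 2 - t * 4)) +
      (1 + ε₀ / 2 + (ε₀ / 2) ^ 2 / 2 + (ε₀ / 2) ^ 3 / 6 + (ε₀ / 2) ^ 4 / 24 + (ε₀ / 2) ^ 5 / 120 +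
        7 / 4320 * (ε₀ / 2) ^ 6) * ε₁ * s ≤ ρ')
    (hρ'1 : ρ' < 1) :
    YM3IR.ClusterDomainClustering (G := SUN N)
      ⟨fundamentalRep (Fin N), N * t, fun _ _ W => W ∈ ClusterDomain (Real.log w) ε₀ ε₁⟩ suFrobDist
      (Real.log w) := by
  have hN0 : (0 : ℝ) < N := by exact_mod_cast (show 0 < N by omega)
  have e4 : (2 : ℝ) * (((3 : ℕ) : ℝ) - 1) = 4 := by norm_num
  have e12 : (6 : ℝ) * (((3 : ℕ) : ℝ) - 1) = 12 := by norm_num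
  refine clusterDomainClustering_of_torusClusteringOnBallW (A := 8 * N) fun β hβ0 hββs => ?_
  have hβt : |β| / N ≤ t := by
    rw [abs_of_nonneg hβ0, div_le_iff₀ hN0, mul_comm]
    exact hββs
  exact suN_torusClusteringOnBallW_of_cert (d := 3) (by norm_num) hN hw hβt (by rw [e4]; exact ht) h0 h1 hε₁ hs
    (by rw [e4]; exact hqs) (by rw [e4, e12]; exact hcert) hρ'1

end Summit.Ventures.YMGap.RobustBallSUN

end
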